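import Literature.NumberTheory.Automorphic.RootSubgroupProofs
import Literature.NumberTheory.Automorphic.TorusRigidity
import HarnessLib

/-!
# Root subgroups, II: the Borel subgroups containing `T` (Springer 6.4.12, 7.1.4) and the
discharge of `atMostTwo_isBorelIn_of_central`

Trunk T-AUTOMORPHIC (G25 AutomorphicL); continuation of `RootSubgroupProofs.lean` (namespace
`Literature.Automorphic`), devoted to the named fact `Literature.NumberTheory.Automorphic.rootSubgroup_unique` (Springer,
*Linear Algebraic Groups*, 2nd ed., 8.1.1 (i): uniqueness of the root subgroup `U_α`). That file
reduced 8.1.1 (i) to three structure-theory inputs `A` (7.6.4 (i)), `C₁`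
(`atMostTwo_isBorelIn_of_central`: in semisimple rank one at most two Borel subgroups contain
`T`, 7.1.4 with 6.4.12) and `C₂` (7.3.3 (ii)). Here `C₁` is **proved** from three textbook
theorems, vendored as named facts:

* `isBorelIn_conj` — Springer 6.2.7 (iii): the Borel subgroups of a connected `G` are conjugate;
* `isMaximalTorusIn_conj_of_isSolvable` — Springer 6.4.1 in the solvable case (6.3.5 (iii) with
  6.3.6 (i)): the maximal tori of a connected solvable group are conjugate;
* `centralizer_eq_of_isMaximalTorusIn` — Springer 7.6.4 (ii): `Z_G(T) = T` for a maximal torus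
  `T` of a connected reductive `G`;

and the proved results

* `exists_mem_normalizer_map_conj_eq` (6.4.12, surjectivity: the Borel subgroups containing a
  maximal torus `T` are conjugate under `N_G(T)`, from the two conjugacy theorems);
* `normConj`, `charConj` (the action of `N(T)` on `T` and on `X*(T)`), with
  `mem_centralizer_of_charConj_eq` (the characters separate the points of `T`, 3.2.3 (b), via
  `eval_mem_charSpan` of `DiagonalizableGroups.lean`);
* `exists_zpow_eq_zpow_of_mem_charactersTrivialOn` (the characters trivial on `S = (Ker α)°` are
  commensurable with `α`: "`T/S ≅ 𝔾ₘ`", 7.1.4 — from the finite index of `S` in `Ker α`, 2.2.1,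
  and the perfect pairing `X × Y → ℤ`, 3.2.11 (i), `exists_dualBases_of_isTorusSubgroup` of
  `TorusCharacters.lean`);
* `charConj_eq_or_eq_inv_of_central` (7.1.4: "*`W_α` has order `≤ 2`*" — an element of `N_G(T)`
  maps `α` to `α^{±1}` when `(Ker α)°` is central; finiteness comes from rigidity,
  `exists_pow_mem_centralizer_of_le_normalizer` of `TorusRigidity.lean`, 3.2.9) and
  `mem_centralizer_of_charConj_eq_of_central` (an element fixing `α` centralises `T`);
* `atMostTwo_isBorelIn_of_central_of_facts : isBorelIn_conj → isMaximalTorusIn_conj_of_isSolvable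
  → centralizer_eq_of_isMaximalTorusIn → atMostTwo_isBorelIn_of_central` and the refined
  assembly `rootSubgroup_unique_of_facts₂` (8.1.1 (i) from 7.6.4 (i), 6.2.7 (iii), 6.4.1,
  7.6.4 (ii), 7.3.3 (ii)).

What remains to discharge `rootSubgroup_unique` is thus the Borel-subgroup theory proper
(6.2.6–6.2.7: fixed point theorem and conjugacy; 6.3.5: connected solvable groups; 7.6.4:
centralisers of tori in reductive groups; 7.3.3: semisimple rank one), for which the `k`-points
vocabulary still lacks quotients `G/B`, complete varieties and dimension theory.

## References

* [SpringerLAG1998] T. A. Springer, *Linear Algebraic Groups*, 2nd ed., Progress in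
  Mathematics 9, Birkhäuser (1998): 3.2.3, 3.2.9, 3.2.11 (i), 6.2.7 (iii), 6.3.5 (iii),
  6.3.6 (i), 6.4.1, 6.4.12, 7.1.4, 7.3.3 (ii), 7.6.4, 8.1.1 (i).
-/

open scoped MatrixGroups

namespace Literature.NumberTheory.Automorphic

variable {k : Type*} [Field k] {n : Type*} [Fintype n] [DecidableEq n]

attribute [local instance] zariskiTopologyGL

/-! ### Named facts: the conjugacy theorems and the Cartan subgroups of a reductive group -/

section Facts

/-- **Springer 6.2.7 (iii): Borel subgroups are conjugate.** *"Two Borel subgroups of `G` are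
conjugate"* (`G` a linear algebraic group; proof: Borel's fixed point theorem 6.2.6 on the
complete variety `G/P`). Stated for a Zariski-connected `G ≤ GL n k` over an algebraically closed
field, in the vocabulary of `LinearAlgebraicGroups.lean` (`IsBorelIn B G`: a maximal
Zariski-connected solvable subgroup of `G`, Springer 6.2.1), the conjugating element being taken
in `G`. [cite: SpringerLAG1998, 6.2.7 (iii)] -/
def isBorelIn_conj : Prop :=
  ∀ [IsAlgClosed k] {G B B' : Subgroup (GL n k)}, IsZConnected G → IsBorelIn B G →
    IsBorelIn B' G → ∃ g ∈ G, B' = B.map (MulAut.conj g : GL n k →* GL n k)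

/-- **Springer 6.4.1 (solvable case, = 6.3.5 (iii) with 6.3.6 (i)): maximal tori of a connected
solvable group are conjugate.** 6.4.1: *"Two maximal tori of `G` are conjugate"* (`G` a connected
linear algebraic group; "a maximal torus of `G` is a subtorus of `G` that is not strictly
contained in another subtorus", 6.4 — this is `IsMaximalTorusIn`); the proof reduces by
6.2.7 (iii) to the case of a connected solvable `G`, which is 6.3.5 (iii) (with 6.3.6 (i): a
set-theoretically maximal subtorus has the maximal dimension). Vendored in the solvable case only
(the one needed for 6.4.12), over an algebraically closed field, for a Zariski-connected solvable
`G ≤ GL n k`, with the conjugating element in `G`.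
[cite: SpringerLAG1998, 6.4.1 (solvable case: 6.3.5 (iii), 6.3.6 (i))] -/
def isMaximalTorusIn_conj_of_isSolvable : Prop :=
  ∀ [IsAlgClosed k] {G T T' : Subgroup (GL n k)}, IsZConnected G → IsSolvable ↥G →
    IsMaximalTorusIn T G → IsMaximalTorusIn T' G →
    ∃ g ∈ G, T' = T.map (MulAut.conj g : GL n k →* GL n k)

/-- **Springer 7.6.4 (ii): in a reductive group the centraliser of a maximal torus is the torus
itself** (*"Assume `G` to be reductive. (ii) `Z_G(T) = T`, i.e. Cartan subgroups are maximal
tori"*, `G` connected, `T` a maximal torus; proof: 7.6.4 (i) with 6.4.2 (i)). Over an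
algebraically closed field, for a connected reductive `G ≤ GL n k` (`IsConnectedReductive`) and
a maximal torus `T` (`IsMaximalTorusIn`), with `Z_G(T) = G ⊓ centralizer T`.
[cite: SpringerLAG1998, 7.6.4 (ii)] -/
def centralizer_eq_of_isMaximalTorusIn : Prop :=
  ∀ [IsAlgClosed k] {G T : Subgroup (GL n k)}, IsConnectedReductive G → IsMaximalTorusIn T G →
    G ⊓ Subgroup.centralizer (T : Set (GL n k)) = T

end Facts

/-! ### Borel subgroups containing a maximal torus are permuted by its normaliser (6.4.12) -/

section BorelsContainingT

/-- **Springer 6.4.12 (surjectivity half): the Borel subgroups containing a maximal torus `T`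
are conjugate under `N_G(T)`** (*"Surjectivity of the map follows from the conjugacy of maximal
tori of `B`"*). Granted the conjugacy of Borel subgroups (`isBorelIn_conj`, 6.2.7 (iii)) and of
maximal tori of a connected solvable group (`isMaximalTorusIn_conj_of_isSolvable`,
6.4.1/6.3.5 (iii), applied inside a Borel subgroup): if `B, B' ⊇ T` are Borel subgroups of the
connected `G` and `T` is a maximal torus of `G`, then `B' = m B m⁻¹` for some `m ∈ G`
normalising `T`. Proof: `B' = g B g⁻¹`; `T` and `g T g⁻¹` are maximal tori of
`B'`, so `b (g T g⁻¹) b⁻¹ = T` for some `b ∈ B'`, and `m = b g` works.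
[cite: SpringerLAG1998, 6.4.12] -/
theorem exists_mem_normalizer_map_conj_eq (hF₁ : isBorelIn_conj (k := k) (n := n))
    (hF₂ : isMaximalTorusIn_conj_of_isSolvable (k := k) (n := n)) [IsAlgClosed k]
    {G T B B' : Subgroup (GL n k)} (hG : IsZConnected G) (hT : IsMaximalTorusIn T G) (hB : IsBorelIn B G) (hTB : T ≤ B)
    (hB' : IsBorelIn B' G) (hTB' : T ≤ B') :
    ∃ m ∈ G, m ∈ Subgroup.normalizer (T : Set (GL n k)) ∧
      B' = B.map (MulAut.conj m : GL n k →* GL n k) := by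
  obtain ⟨g, hg, rfl⟩ := hF₁ hG hB hB'
  -- `T` and `g T g⁻¹` are maximal tori of the connected group `B' = g B g⁻¹`
  have hTmaxB : IsMaximalTorusIn T B :=
    ⟨hTB, hT.2.1, fun T' h₁ h₂ h₃ => hT.2.2 T' h₁ (h₂.trans hB.1) h₃⟩
  have h1 : IsMaximalTorusIn (T.map (MulAut.conj g : GL n k →* GL n k))
      (B.map (MulAut.conj g : GL n k →* GL n k)) := hTmaxB.map_conj g
  have h2 : IsMaximalTorusIn T (B.map (MulAut.conj g : GL n k →* GL n k)) :=
    ⟨hTB', hT.2.1, fun T' h₁ h₂ h₃ => hT.2.2 T' h₁ (h₂.trans hB'.1) h₃⟩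
  obtain ⟨b, hb, hbT⟩ := hF₂ hB'.2.1 hB'.2.2.1 h1 h2
  refine ⟨b * g, G.mul_mem (hB'.1 hb) hg, ?_, ?_⟩
  · rw [Subgroup.mem_normalizer_iff_map_conj_eq, ← map_conj_map_conj, ← hbT]
  · rw [← map_conj_map_conj,
      Subgroup.mem_normalizer_iff_map_conj_eq.1 (Subgroup.le_normalizer hb)]

end BorelsContainingT

/-! ### The action of `N(T)` on the characters of `T` -/

section NormalizerAction

variable {T : Subgroup (GL n k)} {m : GL n k}

/-- For `m` normalising `T`, the automorphism `t ↦ m t m⁻¹` of `T` (the action of `N(T)` on `T`,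
Springer 3.2.9, 7.1.4). [folklore] -/
def normConj (hm : m ∈ Subgroup.normalizer (T : Set (GL n k))) : ↥T →* ↥T where
  toFun t := ⟨m * t * m⁻¹, (Subgroup.mem_normalizer_iff.1 hm t).1 t.2⟩
  map_one' := Subtype.ext (by simp)
  map_mul' a b := Subtype.ext (by simp [mul_assoc])

/-- `normConj hm t = m t m⁻¹`. [folklore] -/
@[simp] lemma coe_normConj_apply (hm : m ∈ Subgroup.normalizer (T : Set (GL n k))) (t : ↥T) :
    ((normConj hm t : ↥T) : GL n k) = m * t * m⁻¹ := rfl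

/-- Pulling an algebraic character back along `t ↦ m t m⁻¹` gives an algebraic character
(inner automorphisms are morphisms, Springer 2.1.2). [folklore] -/
lemma IsAlgebraicChar.comp_normConj (hm : m ∈ Subgroup.normalizer (T : Set (GL n k)))
    {χ : ↥T →* kˣ} (hχ : IsAlgebraicChar χ) : IsAlgebraicChar (χ.comp (normConj hm)) := by
  obtain ⟨p, hp⟩ := hχ
  refine ⟨MvPolynomial.bind₁ (conjPolyGL m m⁻¹) p, fun t => ?_⟩
  rw [MonoidHom.comp_apply, hp, eval_bind₁]
  exact congrArg (fun f => MvPolynomial.eval f p)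
    (funext fun c => (eval_conjPolyGL m m⁻¹ (t : GL n k) c).symm)

/-- The action `χ ↦ χ ∘ Int(m)|_T` of an element `m ∈ N(T)` on the character group `X*(T)`
(Springer 3.2.9, 7.1.4: the Weyl group acts on `X*(T)`), as an endomorphism of the group
`characterLattice T`. [folklore] -/
def charConj (hm : m ∈ Subgroup.normalizer (T : Set (GL n k))) :
    ↥(characterLattice T) →* ↥(characterLattice T) where
  toFun χ := ⟨(χ : ↥T →* kˣ).comp (normConj hm), IsAlgebraicChar.comp_normConj hm χ.2⟩
  map_one' := Subtype.ext (MonoidHom.ext fun _ => rfl)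
  map_mul' _ _ := Subtype.ext (MonoidHom.ext fun _ => rfl)

/-- `(charConj hm χ) t = χ (m t m⁻¹)`. [folklore] -/
@[simp] lemma coe_charConj_apply (hm : m ∈ Subgroup.normalizer (T : Set (GL n k)))
    (χ : ↥(characterLattice T)) (t : ↥T) :
    ((charConj hm χ : ↥(characterLattice T)) : ↥T →* kˣ) t = (χ : ↥T →* kˣ) (normConj hm t) :=
  rfl

/-- `m ^ j` normalises `T` if `m` does. [folklore] -/
lemma pow_mem_normalizer (hm : m ∈ Subgroup.normalizer (T : Set (GL n k))) (j : ℕ) :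
    m ^ j ∈ Subgroup.normalizer (T : Set (GL n k)) :=
  Subgroup.pow_mem _ hm j

/-- Iterating the action of `m` is the action of `m ^ j`:
`(charConj hm)^[j] χ = χ ∘ Int(m ^ j)|_T`. [folklore] -/
lemma charConj_iterate_apply (hm : m ∈ Subgroup.normalizer (T : Set (GL n k))) (j : ℕ)
    (χ : ↥(characterLattice T)) (t : ↥T) :
    (((charConj hm)^[j] χ : ↥(characterLattice T)) : ↥T →* kˣ) t =
      (χ : ↥T →* kˣ) (normConj (pow_mem_normalizer hm j) t) := by
  induction j generalizing t with
  | zero =>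
    simp only [Function.iterate_zero, id_eq]
    congr 1
    apply Subtype.ext
    simp
  | succ j ih =>
    rw [Function.iterate_succ_apply', coe_charConj_apply, ih]
    congr 1
    apply Subtype.ext
    simp only [coe_normConj_apply, pow_succ]
    group

/-- If `m ^ j` centralises `T` then the action of `m` on `X*(T)` has order dividing `j`.
[folklore] -/
lemma charConj_iterate_eq_self (hm : m ∈ Subgroup.normalizer (T : Set (GL n k))) {j : ℕ}
    (hj : m ^ j ∈ Subgroup.centralizer (T : Set (GL n k))) (χ : ↥(characterLattice T)) :
    (charConj hm)^[j] χ = χ := by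
  apply Subtype.ext
  apply MonoidHom.ext
  intro t
  rw [charConj_iterate_apply]
  congr 1
  apply Subtype.ext
  have h := Subgroup.mem_centralizer_iff.1 hj t t.2
  rw [coe_normConj_apply, ← h, mul_inv_cancel_right]

/-- The action of `m m'` is the composite of the actions: `χ ∘ Int(m m') = (χ ∘ Int(m)) ∘ Int(m')`.
[folklore] -/
lemma charConj_mul (hm : m ∈ Subgroup.normalizer (T : Set (GL n k))) {m' : GL n k}
    (hm' : m' ∈ Subgroup.normalizer (T : Set (GL n k))) (χ : ↥(characterLattice T)) :
    charConj (Subgroup.mul_mem _ hm hm') χ = charConj hm' (charConj hm χ) := by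
  apply Subtype.ext
  apply MonoidHom.ext
  intro t
  simp only [coe_charConj_apply]
  congr 1
  apply Subtype.ext
  simp only [coe_normConj_apply, mul_inv_rev]
  group

/-- The action of `m⁻¹` is inverse to that of `m`. [folklore] -/
lemma charConj_inv_charConj (hm : m ∈ Subgroup.normalizer (T : Set (GL n k)))
    (χ : ↥(characterLattice T)) :
    charConj (Subgroup.inv_mem _ hm) (charConj hm χ) = χ := by
  apply Subtype.ext
  apply MonoidHom.ext
  intro t
  simp only [coe_charConj_apply]
  congr 1
  apply Subtype.ext
  simp only [coe_normConj_apply, inv_inv]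
  group

/-- **Characters separate the points of a torus** (Springer 3.2.3 (b): the characters span
`k[T]`; here via `eval_mem_charSpan` of `DiagonalizableGroups.lean`): over an algebraically
closed field, if `m` normalises a commutative subgroup `T` of semisimple matrices and fixes every
algebraic character of `T`, then `m` centralises `T`. [cite: SpringerLAG1998, 3.2.3 (b)] -/
theorem mem_centralizer_of_charConj_eq [IsAlgClosed k] (hcomm : IsMulCommutative ↥T)
    (hss : ∀ t ∈ T, IsSemisimpleElt t) (hm : m ∈ Subgroup.normalizer (T : Set (GL n k)))
    (h : ∀ χ : ↥(characterLattice T), charConj hm χ = χ) :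
    m ∈ Subgroup.centralizer (T : Set (GL n k)) := by
  haveI := hcomm
  rw [Subgroup.mem_centralizer_iff]
  intro t ht
  -- every function in the span of the characters takes the same value at `t` and `m t m⁻¹`
  have key : ∀ f ∈ charSpan T, f (normConj hm ⟨t, ht⟩) = f ⟨t, ht⟩ := by
    intro f hf
    induction hf using Submodule.span_induction with
    | mem f hf =>
      obtain ⟨χ, rfl⟩ := hf
      have hχ := congrArg (fun ψ : ↥(characterLattice T) => (((ψ : ↥T →* kˣ) ⟨t, ht⟩ : kˣ) : k))
        (h χ)
      simpa using hχ
    | zero => rfl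
    | add f g _ _ hf hg => simp [hf, hg]
    | smul a f _ hf => simp [hf]
  have hcoord : glCoordFun (m * t * m⁻¹) = glCoordFun t := by
    funext c
    have := key _ (eval_mem_charSpan hss (MvPolynomial.X c))
    simpa using this
  have heq : m * t * m⁻¹ = t := glCoordFun_injective hcoord
  calc t * m = m * t * m⁻¹ * m := by rw [heq]
    _ = m * t := by group

end NormalizerAction

/-! ### Characters trivial on the singular subtorus `(Ker α)°` -/

section SingularTorus

variable {T : Subgroup (GL n k)}

/-- The subgroup of characters of `T` that are trivial on a subgroup `S` (used with
`S = (Ker α)°`; these are the characters of `T/S`, Springer 7.1.4). [folklore] -/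
def charactersTrivialOn (T S : Subgroup (GL n k)) : Subgroup ↥(characterLattice T) where
  carrier := {χ | ∀ t : ↥T, (t : GL n k) ∈ S → (χ : ↥T →* kˣ) t = 1}
  one_mem' _ _ := rfl
  mul_mem' {χ ψ} hχ hψ t ht := by
    change (χ : ↥T →* kˣ) t * (ψ : ↥T →* kˣ) t = 1
    rw [hχ t ht, hψ t ht, one_mul]
  inv_mem' {χ} hχ t ht := by
    change ((χ : ↥T →* kˣ) t)⁻¹ = 1
    rw [hχ t ht, inv_one]

/-- Membership in `charactersTrivialOn T S`. [folklore] -/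
lemma mem_charactersTrivialOn_iff {S : Subgroup (GL n k)} {χ : ↥(characterLattice T)} :
    χ ∈ charactersTrivialOn T S ↔ ∀ t : ↥T, (t : GL n k) ∈ S → (χ : ↥T →* kˣ) t = 1 :=
  Iff.rfl

/-- Over an algebraically closed field every unit has a `d`-th root for `d ≠ 0`. [folklore] -/
lemma exists_zpow_eq_of_isAlgClosed [IsAlgClosed k] (y : kˣ) {d : ℤ} (hd : d ≠ 0) :
    ∃ x : kˣ, x ^ d = y := by
  -- positive exponents
  have hpos : ∀ (z : kˣ) (m : ℕ), 0 < m → ∃ x : kˣ, x ^ m = z := by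
    intro z m hm
    obtain ⟨x, hx⟩ := IsAlgClosed.exists_pow_nat_eq (z : k) hm
    have hx0 : x ≠ 0 := by
      rintro rfl
      rw [zero_pow hm.ne'] at hx
      exact z.ne_zero hx.symm
    refine ⟨Units.mk0 x hx0, Units.ext ?_⟩
    simp [hx]
  rcases Int.eq_nat_or_neg d with ⟨m, rfl | rfl⟩
  · have hm : 0 < m := by omega
    obtain ⟨x, hx⟩ := hpos y m hm
    exact ⟨x, by rw [zpow_natCast, hx]⟩
  · have hm : 0 < m := by omega
    obtain ⟨x, hx⟩ := hpos y⁻¹ m hm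
    exact ⟨x, by rw [zpow_neg, zpow_natCast, hx, inv_inv]⟩

/-- **The characters trivial on `(Ker α)°` are commensurable with `α`** (the lattice-theoretic
content of Springer 7.1.4 "*`T/S` is isomorphic to `𝔾ₘ`*", `S = (Ker α)°`): for a torus `T`
over an algebraically closed field, a non-trivial `α ∈ X*(T)` and `χ ∈ X*(T)` trivial on
`(Ker α)°`, one has `χ ^ a = α ^ c` for some integers `a ≠ 0`, `c`. Proof: `(Ker α)°` has finite
index `m₀` in `Ker α` (2.2.1), so `ψ = χ ^ m₀` is trivial on `Ker α`; by the perfect pairing of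
3.2.11 (i) (`exists_dualBases_of_isTorusSubgroup`) there is a cocharacter `λ` with
`d = ⟨α, λ⟩ ≠ 0`; for `t ∈ T` and `x ^ d = α(t)` the element `λ(x) t⁻¹` lies in `Ker α`, whence
`ψ(t) = x ^ ⟨ψ, λ⟩` and `ψ ^ d = α ^ ⟨ψ, λ⟩`. [cite: SpringerLAG1998, 7.1.4 with 3.2.11 (i)] -/
theorem exists_zpow_eq_zpow_of_mem_charactersTrivialOn [IsAlgClosed k] (hT : IsTorusSubgroup T)
    {α : ↥(characterLattice T)} (hα : (α : ↥T →* kˣ) ≠ 1) {χ : ↥(characterLattice T)}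
    (hχ : χ ∈ charactersTrivialOn T
      (identityComponent ((α : ↥T →* kˣ).ker.map T.subtype))) :
    ∃ a c : ℤ, a ≠ 0 ∧ χ ^ a = α ^ c := by
  haveI : IsMulCommutative ↥T := hT.2.1
  set K : Subgroup (GL n k) := (α : ↥T →* kˣ).ker.map T.subtype with hK
  have hKalg : IsAlgebraicSubgroup K := isAlgebraicSubgroup_map_ker hT.1.1 α.2
  -- (1) `χ ^ m₀` is trivial on `Ker α`
  set m₀ : ℕ := ((identityComponent K).subgroupOf K).index with hm₀def
  have hm₀ : m₀ ≠ 0 := (finiteIndex_identityComponent hKalg).index_ne_zero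
  haveI := normal_identityComponent (H := K)
  set ψ : ↥(characterLattice T) := χ ^ m₀ with hψ
  have hψK : ∀ t : ↥T, (α : ↥T →* kˣ) t = 1 → (ψ : ↥T →* kˣ) t = 1 := by
    intro t ht
    have htK : (t : GL n k) ∈ K := ⟨t, (MonoidHom.mem_ker).2 ht, rfl⟩
    have hpow := Subgroup.pow_index_mem ((identityComponent K).subgroupOf K) ⟨t, htK⟩
    rw [Subgroup.mem_subgroupOf, SubmonoidClass.coe_pow] at hpow
    have h1 := hχ (t ^ m₀) (by simpa using hpow)
    rw [map_pow] at h1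
    rw [hψ, Subgroup.coe_pow, MonoidHom.pow_apply, h1]
  -- (2) a cocharacter `γ` with `d = ⟨α, γ⟩ ≠ 0`
  obtain ⟨r, bX, bY, hpair⟩ := exists_dualBases_of_isTorusSubgroup hT
  obtain ⟨i, hi⟩ : ∃ i, bX (Additive.ofMul α) i ≠ 0 := by
    by_contra hcon
    push Not at hcon
    apply hα
    have h0 : bX (Additive.ofMul α) = 0 := funext hcon
    have h1 : Additive.ofMul α = 0 := bX.injective (by rw [h0, map_zero])
    have h2 : α = 1 := Additive.ofMul.injective h1
    rw [h2, Subgroup.coe_one]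
  set γ : ↥(cocharacterLattice T) := Additive.toMul (bY.symm (Pi.single i 1)) with hγ
  set d : ℤ := charPairingInt (α : ↥T →* kˣ) (γ : kˣ →* ↥T) with hd
  have hdi : d = bX (Additive.ofMul α) i := by
    rw [hd, hpair]
    simp [hγ, Pi.single_apply]
  have hd0 : d ≠ 0 := hdi ▸ hi
  set c : ℤ := charPairingInt (ψ : ↥T →* kˣ) (γ : kˣ →* ↥T) with hc
  have hαγ : ∀ x : kˣ, (α : ↥T →* kˣ) ((γ : kˣ →* ↥T) x) = x ^ d := fun x =>
    charPairingInt_spec_holds α.2 γ.2 x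
  have hψγ : ∀ x : kˣ, (ψ : ↥T →* kˣ) ((γ : kˣ →* ↥T) x) = x ^ c := fun x =>
    charPairingInt_spec_holds ψ.2 γ.2 x
  -- (3) `ψ ^ d = α ^ c`
  have hψα : ψ ^ d = α ^ c := by
    apply Subtype.ext
    apply MonoidHom.ext
    intro t
    obtain ⟨x, hx⟩ := exists_zpow_eq_of_isAlgClosed ((α : ↥T →* kˣ) t) hd0
    have hker : (α : ↥T →* kˣ) ((γ : kˣ →* ↥T) x * t⁻¹) = 1 := by
      rw [map_mul, map_inv, hαγ, hx, mul_inv_cancel]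
    have hψt : (ψ : ↥T →* kˣ) t = x ^ c := by
      have h := hψK _ hker
      rw [map_mul, map_inv, hψγ, mul_inv_eq_one] at h
      exact h.symm
    rw [Subgroup.coe_zpow, Subgroup.coe_zpow, MonoidHom.zpow_apply, MonoidHom.zpow_apply, hψt,
      ← hx, ← zpow_mul, ← zpow_mul, mul_comm]
  refine ⟨m₀ * d, c, mul_ne_zero (Int.natCast_ne_zero.2 hm₀) hd0, ?_⟩
  rw [zpow_mul, zpow_natCast]
  exact hψα

end SingularTorus

/-! ### Semisimple rank one: `W_α` has order `≤ 2` (Springer 7.1.4) -/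

section RankOne

variable {G T : Subgroup (GL n k)} {m : GL n k}

/-- **Springer 7.1.4: when `S = (Ker α)°` is central, an element of `N_G(T)` maps `α` to
`±α`.** For a torus `T` in `G ≤ GL n k` over an algebraically closed field, a non-trivial
`α ∈ X*(T)` with `(Ker α)°` central in `G`, and `m ∈ G` normalising `T`: `α ∘ Int(m) = α` or
`α⁻¹`. Proof ("*`W_α` is isomorphic to the Weyl group of `(G_α/S, T/S)`; since `T/S ≅ 𝔾ₘ` it
has order `≤ 2`*"): the action `σ` of `m` on `X*(T)` has finite order (rigidity 3.2.9:
`m ^ j ∈ Z(T)` for some `j ≥ 1`), maps every `χ` to `χ` times a character trivial on `S`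
(`S` is central), and the characters trivial on `S` are commensurable with `α`; so
`σ(α) ^ a = α ^ c` with `a ≠ 0`, and iterating, `α ^ (a ^ j) = α ^ (c ^ j)`, whence `c = ±a` and
`σ(α) = α ^ {±1}` (`X*(T)` is torsion-free). [cite: SpringerLAG1998, 7.1.4] -/
theorem charConj_eq_or_eq_inv_of_central [IsAlgClosed k] (hG : IsAlgebraicSubgroup G)
    (hT : IsTorusSubgroup T) {α : ↥(characterLattice T)} (hα : (α : ↥T →* kˣ) ≠ 1)
    (hcen : G ≤ Subgroup.centralizer
      ((identityComponent ((α : ↥T →* kˣ).ker.map T.subtype) : Subgroup (GL n k)) :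
        Set (GL n k)))
    (hmG : m ∈ G) (hm : m ∈ Subgroup.normalizer (T : Set (GL n k))) :
    charConj hm α = α ∨ charConj hm α = α⁻¹ := by
  haveI : IsMulCommutative ↥T := hT.2.1
  haveI := isMulTorsionFree_characterLattice hT.1
  set S : Subgroup (GL n k) := identityComponent ((α : ↥T →* kˣ).ker.map T.subtype) with hS
  set σ := charConj hm with hσ
  -- finite order
  obtain ⟨j, hj, hjcen⟩ := exists_pow_mem_centralizer_of_le_normalizer
    (hG.inf hT.1.1.normalizer) hT.2.1 hT.2.2 (inf_le_right : G ⊓ _ ≤ _) ⟨hmG, hm⟩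
  have hσj : ∀ χ, σ^[j] χ = χ := charConj_iterate_eq_self hm hjcen
  -- `σ α / α` is trivial on `S`, hence so is `σ α`
  have hσαS : σ α ∈ charactersTrivialOn T S := by
    intro t ht
    have hmt : m * t * m⁻¹ = t := by
      have h := Subgroup.mem_centralizer_iff.1 (hcen hmG) t ht
      rw [← h, mul_inv_cancel_right]
    have hαt : (α : ↥T →* kˣ) t = 1 := by
      -- `t ∈ S ≤ Ker α`
      have htK := identityComponent_le _ ht
      obtain ⟨t', ht', htt'⟩ := htK
      have : t' = t := Subtype.ext htt'
      subst this
      exact (MonoidHom.mem_ker).1 ht'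
    rw [hσ, coe_charConj_apply]
    have : normConj hm t = t := Subtype.ext hmt
    rw [this, hαt]
  obtain ⟨a, c, ha, hac⟩ := exists_zpow_eq_zpow_of_mem_charactersTrivialOn hT hα hσαS
  -- iterate: `σ^[i] α ^ (a ^ i) = α ^ (c ^ i)`
  have hiter : ∀ i : ℕ, (σ^[i] α) ^ (a ^ i) = α ^ (c ^ i) := by
    intro i
    induction i with
    | zero => simp
    | succ i ih =>
      rw [Function.iterate_succ_apply', pow_succ, zpow_mul, ← map_zpow, ih, map_zpow,
        pow_succ, mul_comm (c ^ i) c, zpow_mul, ← zpow_mul (σ α), mul_comm (c ^ i) a, zpow_mul,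
        hac]
  have hαj : α ^ (a ^ j) = α ^ (c ^ j) := by rw [← hiter j, hσj]
  -- `X*(T)` torsion-free and `α ≠ 1` force `a ^ j = c ^ j`
  have hα1 : α ≠ 1 := fun h => hα (by rw [h, Subgroup.coe_one])
  have hexp : a ^ j = c ^ j := by
    by_contra hne
    apply hα1
    have h' : α ^ (a ^ j - c ^ j) = 1 := by rw [zpow_sub, hαj, mul_inv_cancel]
    exact (zpow_left_inj (sub_ne_zero.2 hne)).1 (h'.trans (one_zpow _).symm)
  have hca : c = a ∨ c = -a := by
    have h1 : a.natAbs ^ j = c.natAbs ^ j := by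
      rw [← Int.natAbs_pow, ← Int.natAbs_pow, hexp]
    have h2 : a.natAbs = c.natAbs := Nat.pow_left_injective hj.ne' h1
    rcases Int.natAbs_eq_natAbs_iff.1 h2.symm with h | h
    · exact Or.inl h
    · exact Or.inr h
  rcases hca with rfl | rfl
  · left
    exact (zpow_left_inj ha).1 hac
  · right
    rw [zpow_neg, ← inv_zpow] at hac
    have ha' : a ≠ 0 := by simpa using ha
    exact (zpow_left_inj ha').1 hac

/-- **Springer 7.1.4, continued: an element of `N_G(T)` fixing `α` centralises `T`.** In the
situation of `charConj_eq_or_eq_inv_of_central`, if moreover `α ∘ Int(m) = α` then `m`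
centralises `T`: the action `σ` of `m` on `X*(T)` fixes the characters commensurable with `α`,
i.e. those trivial on `S`, so `σ χ = χ δ(χ)` with `δ(χ)` fixed by `σ`; then `χ = σ^j χ = χ δ(χ)^j`
gives `δ(χ) = 1`, `σ = id`, and the characters separate the points of `T` (3.2.3).
[cite: SpringerLAG1998, 7.1.4 with 3.2.9] -/
theorem mem_centralizer_of_charConj_eq_of_central [IsAlgClosed k] (hG : IsAlgebraicSubgroup G)
    (hT : IsTorusSubgroup T) {α : ↥(characterLattice T)} (hα : (α : ↥T →* kˣ) ≠ 1)
    (hcen : G ≤ Subgroup.centralizer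
      ((identityComponent ((α : ↥T →* kˣ).ker.map T.subtype) : Subgroup (GL n k)) :
        Set (GL n k)))
    (hmG : m ∈ G) (hm : m ∈ Subgroup.normalizer (T : Set (GL n k)))
    (hfix : charConj hm α = α) : m ∈ Subgroup.centralizer (T : Set (GL n k)) := by
  haveI : IsMulCommutative ↥T := hT.2.1
  haveI := isMulTorsionFree_characterLattice hT.1
  set S : Subgroup (GL n k) := identityComponent ((α : ↥T →* kˣ).ker.map T.subtype) with hS
  set σ := charConj hm with hσ
  obtain ⟨j, hj, hjcen⟩ := exists_pow_mem_centralizer_of_le_normalizer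
    (hG.inf hT.1.1.normalizer) hT.2.1 hT.2.2 (inf_le_right : G ⊓ _ ≤ _) ⟨hmG, hm⟩
  have hσj : ∀ χ, σ^[j] χ = χ := charConj_iterate_eq_self hm hjcen
  -- `δ χ = σ χ / χ` is trivial on `S`
  have hδS : ∀ χ, σ χ / χ ∈ charactersTrivialOn T S := by
    intro χ t ht
    have hmt : m * t * m⁻¹ = t := by
      have h := Subgroup.mem_centralizer_iff.1 (hcen hmG) t ht
      rw [← h, mul_inv_cancel_right]
    have : normConj hm t = t := Subtype.ext hmt
    rw [Subgroup.coe_div, MonoidHom.div_apply, hσ, coe_charConj_apply, this, div_self']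
  -- `σ` fixes every character trivial on `S`
  have hfixS : ∀ χ ∈ charactersTrivialOn T S, σ χ = χ := by
    intro χ hχ
    obtain ⟨a, c, ha, hac⟩ := exists_zpow_eq_zpow_of_mem_charactersTrivialOn hT hα hχ
    have h : σ χ ^ a = χ ^ a := by
      rw [← map_zpow, hac, map_zpow, hfix]
    exact (zpow_left_inj ha).1 h
  -- hence `σ^[i] χ = χ * δ ^ i` and `δ = 1`
  refine mem_centralizer_of_charConj_eq hT.2.1 hT.2.2 hm fun χ => ?_
  set δ := σ χ / χ with hδ
  have hσδ : σ δ = δ := hfixS δ (hδS χ)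
  have hσχ : σ χ = χ * δ := by rw [hδ, mul_div_cancel]
  have hiter : ∀ i : ℕ, σ^[i] χ = χ * δ ^ i := by
    intro i
    induction i with
    | zero => simp
    | succ i ih =>
      rw [Function.iterate_succ_apply', ih, map_mul, map_pow, hσδ, hσχ, pow_succ, mul_assoc,
        mul_comm δ (δ ^ i)]
  have hδj : δ ^ j = 1 := by
    have h := hiter j
    rw [hσj] at h
    exact mul_eq_left.1 h.symm
  have hδ1 : δ = 1 := (pow_eq_one_iff_left hj.ne').1 hδj
  rw [hσχ, hδ1, mul_one]

end RankOne

/-! ### Discharge of `atMostTwo_isBorelIn_of_central`; the refined assembly of 8.1.1 (i) -/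

section AtMostTwo

/-- **At most two Borel subgroups contain `T` in semisimple rank one** — the named fact
`atMostTwo_isBorelIn_of_central` of `RootSubgroupProofs.lean` (Springer 7.1.4 with 6.4.12),
PROVED from the conjugacy of Borel subgroups (`isBorelIn_conj`, 6.2.7 (iii)), the conjugacy of
maximal tori of a Borel subgroup (`isMaximalTorusIn_conj_of_isSolvable`, 6.4.1/6.3.5 (iii))
and `Z_G(T) = T` (`centralizer_eq_of_isMaximalTorusIn`, 7.6.4 (ii)). Proof: the Borel subgroups containing `T` are `m B₁ m⁻¹` with `m ∈ N_G(T)`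
(`exists_mem_normalizer_map_conj_eq`, 6.4.12); such an `m` maps `α` to `α^{±1}`
(`charConj_eq_or_eq_inv_of_central`, 7.1.4), and if it fixes `α` it centralises `T`
(`mem_centralizer_of_charConj_eq_of_central`), so lies in `Z_G(T) = T ⊆ B₁`; among three Borel
subgroups `B₁, m₂ B₁ m₂⁻¹, m₃ B₁ m₃⁻¹ ⊇ T` either some `mᵢ` fixes `α`, or `m₂⁻¹ m₃` does.
[cite: SpringerLAG1998, 7.1.4 with 6.4.12] -/
theorem atMostTwo_isBorelIn_of_central_of_facts (hF₁ : isBorelIn_conj (k := k) (n := n))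
    (hF₂ : isMaximalTorusIn_conj_of_isSolvable (k := k) (n := n))
    (hF₃ : centralizer_eq_of_isMaximalTorusIn (k := k) (n := n)) :
    atMostTwo_isBorelIn_of_central (k := k) (n := n) := by
  intro _ G T hG hT α hα hcen B₁ B₂ B₃ hB₁ hT₁ hB₂ hT₂ hB₃ hT₃
  obtain ⟨m₂, hm₂G, hm₂N, rfl⟩ :=
    exists_mem_normalizer_map_conj_eq hF₁ hF₂ hG.1 hT hB₁ hT₁ hB₂ hT₂
  obtain ⟨m₃, hm₃G, hm₃N, rfl⟩ :=
    exists_mem_normalizer_map_conj_eq hF₁ hF₂ hG.1 hT hB₁ hT₁ hB₃ hT₃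
  have hTtorus : IsTorusSubgroup T := hT.2.1
  have hα1 : (α : ↥T →* kˣ) ≠ 1 := hα.1
  -- an element of `N_G(T)` fixing `α` lies in `Z_G(T) = T ⊆ B₁`
  have key : ∀ {m : GL n k} (hmG : m ∈ G) (hmN : m ∈ Subgroup.normalizer (T : Set (GL n k))),
      charConj hmN α = α → B₁.map (MulAut.conj m : GL n k →* GL n k) = B₁ := by
    intro m hmG hmN hfix
    have hmZ := mem_centralizer_of_charConj_eq_of_central hG.1.1 hTtorus hα1 hcen hmG hmN hfix
    have hmT : m ∈ T := by
      rw [← hF₃ hG hT]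
      exact ⟨hmG, hmZ⟩
    exact Subgroup.mem_normalizer_iff_map_conj_eq.1 (Subgroup.le_normalizer (hT₁ hmT))
  rcases charConj_eq_or_eq_inv_of_central hG.1.1 hTtorus hα1 hcen hm₂G hm₂N with h₂ | h₂
  · exact Or.inl (key hm₂G hm₂N h₂).symm
  rcases charConj_eq_or_eq_inv_of_central hG.1.1 hTtorus hα1 hcen hm₃G hm₃N with h₃ | h₃
  · exact Or.inr (Or.inl (key hm₃G hm₃N h₃).symm)
  -- both `m₂` and `m₃` invert `α`, so `m₂⁻¹ m₃` fixes it
  refine Or.inr (Or.inr ?_)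
  have hmN : m₂⁻¹ * m₃ ∈ Subgroup.normalizer (T : Set (GL n k)) :=
    Subgroup.mul_mem _ (Subgroup.inv_mem _ hm₂N) hm₃N
  have hfix : charConj hmN α = α := by
    have e₁ : charConj (Subgroup.inv_mem _ hm₂N) α = α⁻¹ := by
      have h := charConj_inv_charConj hm₂N α
      rw [h₂, map_inv, inv_eq_iff_eq_inv] at h
      exact h
    rw [charConj_mul (Subgroup.inv_mem _ hm₂N) hm₃N, e₁, map_inv, h₃, inv_inv]
  have hB := key (G.mul_mem (G.inv_mem hm₂G) hm₃G) hmN hfix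
  calc B₁.map (MulAut.conj m₂ : GL n k →* GL n k)
      = (B₁.map (MulAut.conj (m₂⁻¹ * m₃) : GL n k →* GL n k)).map
          (MulAut.conj m₂ : GL n k →* GL n k) := by rw [hB]
    _ = B₁.map (MulAut.conj (m₂ * (m₂⁻¹ * m₃)) : GL n k →* GL n k) := map_conj_map_conj _ _ _
    _ = B₁.map (MulAut.conj m₃ : GL n k →* GL n k) := by rw [mul_inv_cancel_left]

variable {G T : Subgroup (GL n k)}

/-- **Springer 8.1.1 (i), uniqueness of root subgroups, from five textbook theorems.** The named
fact `rootSubgroup_unique` follows from: `Z_G(S)` connected reductive for a subtorus `S`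
(`isConnectedReductive_centralizer_torus`, 7.6.4 (i)), conjugacy of Borel subgroups
(`isBorelIn_conj`, 6.2.7 (iii)), conjugacy of maximal tori in a connected solvable group
(`isMaximalTorusIn_conj_of_isSolvable`, 6.4.1/6.3.5 (iii)),
`Z_G(T) = T` (`centralizer_eq_of_isMaximalTorusIn`, 7.6.4 (ii)) and the Borel subgroups
`T · U_{±α}` in semisimple rank one (`exists_rootHom_sup_isBorelIn_of_central`, 7.3.3 (ii)) —
combining `rootSubgroup_unique_of_facts` with `atMostTwo_isBorelIn_of_central_of_facts`.
[cite: SpringerLAG1998, 8.1.1 (i), proof] -/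
theorem rootSubgroup_unique_of_facts₂
    (hA : isConnectedReductive_centralizer_torus (k := k) (n := n))
    (hF₁ : isBorelIn_conj (k := k) (n := n))
    (hF₂ : isMaximalTorusIn_conj_of_isSolvable (k := k) (n := n))
    (hF₃ : centralizer_eq_of_isMaximalTorusIn (k := k) (n := n))
    (hC₂ : exists_rootHom_sup_isBorelIn_of_central (k := k) (n := n)) :
    rootSubgroup_unique (G := G) (T := T) :=
  rootSubgroup_unique_of_facts hA (atMostTwo_isBorelIn_of_central_of_facts hF₁ hF₂ hF₃) hC₂

end AtMostTwo

end Literature.NumberTheory.Automorphic
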